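import Summits.HubbardSuperconductivity.HubbardSuperconductivity.Theorems.WidthHaldaneEnergyResponse

/-!
# From a low-energy window law to an energy-cost floor (the Feshbach step without projections)

Crux `WidthHaldaneBridge` (stmt-HubbardSuperconductivity-16311), crux idea `frustration-cost-duality`
(2026-08-17 round): its transfer target is an ENERGY-COST floor `E_N(H₀ + νJ_r) - E_N(H₀) ≥ ν·F` for the
frustrating column Josephson coupling, and its stub S2 (`FeshbachStep`) derives that floor from a
LOW-ENERGY WINDOW LAW — `F ≤ Re⟨φ, J_r φ⟩` for every unit sector vector `φ` of excitation energy
`≤ Ω` — by min–max with spectral projections, at the price `A ↦ A/2`. The step needs no projections and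
loses nothing: for ANY matrices `H`, `V`, any subspace `K`, any floor `E₀` of `H` on the unit sphere
of `K`, any bound `|Re⟨φ, Vφ⟩| ≤ B` there, and any `0 ≤ ν ≤ Ω/(2B)`,

  window law (`Re⟨φ, Hφ⟩ ≤ E₀ + Ω ⇒ F ≤ Re⟨φ, Vφ⟩`)  ⇒  `E₀ + ν·F ≤ E_K(H + νV)`

(test a unit `φ ∈ K`: inside the window the law gives `νF`; outside it the unperturbed energy alone
exceeds `E₀ + Ω ≥ E₀ + 2νB`, and `νRe⟨φ,Vφ⟩ ≥ -νB`). PROVED here, def-free: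

* `le_minEnergyOn_add_smul_of_window` — the generic step (`Matrix.minEnergyOn` is an infimum; no
  Hermiticity is used);
* `tube_windowToCost` — on the tubes: `H = tubeH0`, `K = (N_{L,M}(δ), S^z = 0)`, `E₀ = E_K(tubeH0)`;
* `tube_windowToCost_exists` — the card's shape: `Ω, B > 0` ⇒ `∃ ν > 0` with the cost floor
  (`ν = Ω/(2B)`), FULL constant `F` (not `F/2`);
* `windowToCost` — closed form (the registered sub-goal `windowToCost` of the crux item).

This is the QUANTITATIVE companion of `Theorems/WidthHaldaneFeshbachStep.lean` (line `Sketch`,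
`exists_minEnergyOn_add_smul_ge_of_window` / `feshbachStep`: `∃ ν > 0`): here the admissible coupling
range `0 ≤ ν ≤ Ω/(2B)` and the floor `E₀ + νF` are explicit, which is what a certificate engine
(card `pair-repulsion-dual`: SOS/RDM relaxations with `UniformThermo` as localising constraints) has
to be fed. Combined with `Theorems/WidthHaldaneEnergyResponse.lean`
(`tubeColumnPairCorr_ge_of_energy_floor`: cost floor ⇒ correlator floor in every ground state) it
closes the chain window law ⇒ cost law ⇒ Haldane floor of the card, leaving the window law from
`UniformThermo` as the card's one open step. References: A. Weinhold, J. Phys. A 1 (1968) 305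
(lower bounds from trial windows); V. Bach, J. Fröhlich, I. M. Sigal, Adv. Math. 137 (1998) 299
(Feshbach map — not needed here).
-/

noncomputable section

namespace Summit.HubbardSuperconductivity.HubbardSuperconductivity.Theorems.WidthHaldane

set_option linter.dupNamespace false -- summit = problem name (single-conjunct summit), D-0017

open scoped BigOperators Classical Matrix ComplexConjugate
open Matrix Literature.MathematicalPhysics.QuantumLattice

/-! ### The generic step -/

section Generic

variable {n : Type*} [Fintype n]

/-- **WINDOW LAW ⇒ COST FLOOR (generic).** Let `H`, `V` be any square matrices, `K` a subspace with a
unit vector, `E₀` a floor of `Re⟨φ, Hφ⟩` and `B` a bound of `|Re⟨φ, Vφ⟩|` over the unit vectors of `K`.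
If every unit `φ ∈ K` with `Re⟨φ, Hφ⟩ ≤ E₀ + Ω` has `F ≤ Re⟨φ, Vφ⟩` (window law), `F ≤ B`, and
`0 ≤ ν`, `2Bν ≤ Ω`, then `E₀ + ν·F ≤ E_K(H + νV)`. [folklore] -/
theorem le_minEnergyOn_add_smul_of_window {H V : Matrix n n ℂ} (K : Submodule ℂ (n → ℂ))
    {E₀ Ω B F ν : ℝ} (hne : ∃ ψ ∈ K, star ψ ⬝ᵥ ψ = 1)
    (hE₀ : ∀ φ ∈ K, star φ ⬝ᵥ φ = 1 → E₀ ≤ (star φ ⬝ᵥ H *ᵥ φ).re)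
    (hB : ∀ φ ∈ K, star φ ⬝ᵥ φ = 1 → |(star φ ⬝ᵥ V *ᵥ φ).re| ≤ B)
    (hwin : ∀ φ ∈ K, star φ ⬝ᵥ φ = 1 → (star φ ⬝ᵥ H *ᵥ φ).re ≤ E₀ + Ω → F ≤ (star φ ⬝ᵥ V *ᵥ φ).re)
    (hF : F ≤ B) (hν : 0 ≤ ν) (hνΩ : 2 * B * ν ≤ Ω) :
    E₀ + ν * F ≤ (H + (ν : ℂ) • V).minEnergyOn K := by
  obtain ⟨ψ₀, hψ₀, h₀⟩ := hne
  unfold Matrix.minEnergyOn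
  refine le_csInf ⟨_, ψ₀, hψ₀, h₀, rfl⟩ ?_
  rintro E ⟨φ, hφ, h1, rfl⟩
  have hsplit : (star φ ⬝ᵥ (H + (ν : ℂ) • V) *ᵥ φ).re =
      (star φ ⬝ᵥ H *ᵥ φ).re + ν * (star φ ⬝ᵥ V *ᵥ φ).re := by
    rw [add_mulVec, dotProduct_add, Complex.add_re, smul_mulVec, dotProduct_smul, smul_eq_mul,
      Complex.re_ofReal_mul]
  rw [hsplit]
  have hVB := abs_le.1 (hB φ hφ h1)
  by_cases hw : (star φ ⬝ᵥ H *ᵥ φ).re ≤ E₀ + Ω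
  · have hFφ := hwin φ hφ h1 hw
    have := hE₀ φ hφ h1
    nlinarith
  · push Not at hw
    nlinarith

end Generic

/-! ### On the tubes -/

section Tube

variable (L M : ℕ) [NeZero L] [NeZero M] (Λ : Type) [LinearOrder Λ] [Fintype Λ]
  (e : Λ ≃ ZMod L × ZMod M)

/-- **Window law ⇒ cost floor on the tube** (`δ ≥ -1`): for every matrix `V` with
`|Re⟨φ, Vφ⟩| ≤ B` on the unit vectors of the sector `(N_{L,M}(δ), S^z = 0)`, a window law
`Re⟨φ, H₀φ⟩ ≤ E₀ + Ω ⇒ F ≤ Re⟨φ, Vφ⟩` (`E₀` the sector minimum of `tubeH0`, `F ≤ B`) gives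
`E₀ + νF ≤ E_{(N,0)}(tubeH0 + νV)` for all `0 ≤ ν ≤ Ω/(2B)`. [folklore] -/
theorem tube_windowToCost (U : ℝ) {δ : ℝ} (hδ : -1 ≤ δ) {V : Matrix (Finset (Orb Λ)) (Finset (Orb Λ)) ℂ}
    {Ω B F ν : ℝ}
    (hB : ∀ φ ∈ szSector (tubeFilling L M δ) (0 : ℝ), star φ ⬝ᵥ φ = 1 → |(expect V φ).re| ≤ B)
    (hwin : ∀ φ ∈ szSector (tubeFilling L M δ) (0 : ℝ), star φ ⬝ᵥ φ = 1 →
      (expect (tubeH0 L M Λ e U) φ).re ≤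
          (tubeH0 L M Λ e U).minEnergyOn (szSector (tubeFilling L M δ) 0) + Ω →
        F ≤ (expect V φ).re)
    (hF : F ≤ B) (hν : 0 ≤ ν) (hνΩ : 2 * B * ν ≤ Ω) :
    (tubeH0 L M Λ e U).minEnergyOn (szSector (tubeFilling L M δ) 0) + ν * F ≤
      (tubeH0 L M Λ e U + (ν : ℂ) • V).minEnergyOn (szSector (tubeFilling L M δ) 0) := by
  obtain ⟨ψ, h1, hgs⟩ := exists_unit_isGroundStateInSector_tubeH0_tubeFilling L M Λ e U hδ
  exact le_minEnergyOn_add_smul_of_window (szSector (tubeFilling L M δ) 0) ⟨ψ, hgs.1, h1⟩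
    (fun φ hφ hφ1 => minEnergyOn_le_rayleigh_of_mem (isHermitian_tubeH0 L M Λ e U) _ hφ hφ1)
    hB hwin hF hν hνΩ

/-- **The card's shape** (`frustration-cost-duality`, stub `FeshbachStep`, with the FULL constant): for
`Ω, B > 0` a window law yields some `ν > 0` (`ν = Ω/(2B)`) with
`ν·F ≤ E_{(N,0)}(tubeH0 + νV) - E_{(N,0)}(tubeH0)`. [folklore] -/
theorem tube_windowToCost_exists (U : ℝ) {δ : ℝ} (hδ : -1 ≤ δ)
    {V : Matrix (Finset (Orb Λ)) (Finset (Orb Λ)) ℂ} {Ω B F : ℝ} (hΩ : 0 < Ω) (hB0 : 0 < B)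
    (hB : ∀ φ ∈ szSector (tubeFilling L M δ) (0 : ℝ), star φ ⬝ᵥ φ = 1 → |(expect V φ).re| ≤ B)
    (hwin : ∀ φ ∈ szSector (tubeFilling L M δ) (0 : ℝ), star φ ⬝ᵥ φ = 1 →
      (expect (tubeH0 L M Λ e U) φ).re ≤
          (tubeH0 L M Λ e U).minEnergyOn (szSector (tubeFilling L M δ) 0) + Ω →
        F ≤ (expect V φ).re)
    (hF : F ≤ B) :
    ∃ ν : ℝ, 0 < ν ∧
      ν * F ≤ (tubeH0 L M Λ e U + (ν : ℂ) • V).minEnergyOn (szSector (tubeFilling L M δ) 0) -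
        (tubeH0 L M Λ e U).minEnergyOn (szSector (tubeFilling L M δ) 0) := by
  have h2B : (0 : ℝ) < 2 * B := by positivity
  refine ⟨Ω / (2 * B), div_pos hΩ h2B, ?_⟩
  have h := tube_windowToCost L M Λ e U hδ (ν := Ω / (2 * B)) hB hwin hF (div_pos hΩ h2B).le
    (by rw [mul_div_cancel₀ _ h2B.ne'])
  linarith

end Tube

/-- **WINDOW-TO-COST, closed form** (all binders universally quantified; the registered sub-goal
`windowToCost` of crux stmt-HubbardSuperconductivity-16311 — card `frustration-cost-duality`'s
`FeshbachStep` without projections and without halving the constant). [folklore] -/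
theorem windowToCost : ∀ (L M : ℕ) [NeZero L] [NeZero M] (Λ : Type) [LinearOrder Λ] [Fintype Λ] (e : Λ ≃ ZMod L × ZMod M) (U δ : ℝ), -1 ≤ δ → ∀ (V : Matrix (Finset (Orb Λ)) (Finset (Orb Λ)) ℂ) (Ω B F ν : ℝ), (∀ φ ∈ szSector (tubeFilling L M δ) (0 : ℝ), star φ ⬝ᵥ φ = 1 → |(expect V φ).re| ≤ B) → (∀ φ ∈ szSector (tubeFilling L M δ) (0 : ℝ), star φ ⬝ᵥ φ = 1 → (expect (tubeH0 L M Λ e U) φ).re ≤ (tubeH0 L M Λ e U).minEnergyOn (szSector (tubeFilling L M δ) 0) + Ω → F ≤ (expect V φ).re) → F ≤ B → 0 ≤ ν → 2 * B * ν ≤ Ω → (tubeH0 L M Λ e U).minEnergyOn (szSector (tubeFilling L M δ) 0) + ν * F ≤ (tubeH0 L M Λ e U + (ν : ℂ) • V).minEnergyOn (szSector (tubeFilling L M δ) 0) :=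
  fun L M _ _ Λ _ _ e U _δ hδ _V _Ω _B _F _ν hB hwin hF hν hνΩ =>
    tube_windowToCost L M Λ e U hδ hB hwin hF hν hνΩ

end Summit.HubbardSuperconductivity.HubbardSuperconductivity.Theorems.WidthHaldane

end
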